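import Literature.Probability.DuminilCopinMarkarPanisSlade2026.Door
import Literature.Probability.Percolation.XSpaceDecayTriangle
import HarnessLib

/-!
# Duminil-Copin–Markar–Panis–Slade (2026), nearest-neighbour percolation: behind the door is the
# TRIANGLE CONDITION — Theorem 1.6 at tolerance `δ` + §6.3 + the key give all four mean-field
# exponents (`3ε < d - 6`)

CITATION HEADER. Source: H. Duminil-Copin, A. Markar, R. Panis, G. Slade, *A random walk approach
to high-dimensional critical phenomena*, arXiv:2605.21438v2 (21 May 2026), UNREFEREED (bib key
`DuminilCopinMarkarPanisSlade2026RandomWalk`; held as `lit paper:arxiv-2605.21438`; page numbers = PDF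
pages of v2): Theorem 1.6 with (1.26) (pp. 8–9), §6.3 (pp. 47–49). The step (1.26) ⟹ triangle:
T. Hara, R. van der Hofstad, G. Slade, Ann. Probab. 31 (2003), Prop. 1.7(i) and p. 5 (bib key
`HaraHofstadSlade2003`), as KERNEL-PROVED in `Literature.Probability.Percolation.XSpaceDecayTriangle`;
triangle ⟹ exponents: R. Fitzner, R. van der Hofstad, EJP 22 (2017), Cor. 1.3 (bib key
`FitznerVanDerHofstad2017`), as kernel-proved in `…FitznerVanDerHofstad2017.MeanFieldOfTriangle`.
Origin: build `lace`, unit `b2b-lace-dmps-g4` (fourth generation of the "DMPS route" seat).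
Companions: `…DuminilCopinMarkarPanisSlade2026.BlackBox` (the paper's statements as `Prop`s and the
nearest-neighbour dictionary), `…NearestNeighbourVerdict` (Assumption II FAILS as printed),
`…ErrorTermFloor` (`E ≥ 1 - 1/β`), `…Door` (gen 3: the door as a conditional kernel theorem giving
`θ(p_c) = 0` from Theorem 1.6 and `γ = 1` from Theorem 1.7, the key `NNErrorTermBelow`, the lock
`δ > 1/(2d)`).

WHY THIS FILE. `Door.lean` drew from the conclusion of Theorem 1.6 only `θ(p_c) = 0` (the `x`-space
bound `τ_p(0,x) ≤ C‖x‖_∞^{-(d-2-ε)}` uniform in `p < p_c`, `tau_le_rpow_of_theorem16Conclusion`, fed to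
`τ_{p_c}(0,x) → 0 ⟹ θ(p_c) = 0`) and needed the conclusion of Theorem 1.7 for `γ = 1`. But the same
uniform `x`-space bound gives the TRIANGLE CONDITION `T(p_c) < ∞` as soon as `3(d-2-ε) > 2d`, i.e.
`3ε < d - 6` (new tree theorem `triangleCondition_of_tau_le_rpow_subcrit`: pass to `p_c` by
left-continuity, then the `x`-space criterion `3a > 2d` — the positive half of the tree's
`not_triangleCondition_of_twoPoint_lower`), and the triangle condition gives ALL FOUR mean-field
exponent statements `MeanField d` (`θ(p_c) = 0`, `γ = 1`, `β = 1`, `δ = 2` in the bounded-ratio sense;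
Aizenman–Newman 1984 / Barsky–Aizenman 1991 as proved in the tree, `meanField_of_triangle`). So:

  MEAN-FIELD DOOR (`meanField_of_key`, `d ≥ 2`, `c, C ≥ 0`, `3ε < d - 6`): the conclusion of DMPS
  Theorem 1.6 at ratio constant `c₀ = 1` and tolerance `δ` ∧ "nearest-neighbour percolation obeys
  Def. 1.3 + Assumption I" (§6.3) ∧ the key `E_NN(d) < δ` ⟹ `TriangleCondition d` ⟹ `MeanField d`.

The second door, if a key for it existed, would therefore open onto exactly the room the lace
expansion opens onto (`TriangleCondition d`, cf. `HaraSlade1990_triangleCondition_of_laceFacts`,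
`…_of_laceBootstrap`): DMPS and the lace expansion are two routes to ONE sufficient condition, not to
two different sets of conclusions. Theorem 1.7 is no longer needed for `γ = 1` (it still supplies the
explicit amplitudes (1.28), `Door.gammaEqOneBoundedRatio_of_theorem17Conclusion`, and one of the two
lock paths). At the paper's `ε ∈ (0,1)` the restriction `3ε < d - 6` is void for `d ≥ 9` and asks
`ε < 1/3`, `ε < 2/3` at `d = 7, 8` — admissible there since Theorem 1.6 is stated for every
`ε ∈ (0,1)` (with `𝛅 = 𝛅(d, c₀, ε)`). The LOCK is unchanged: any `δ` turning the key has `δ > 1/(2d)`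
(`Door.inv_two_mul_lt_of_nnErrorTermBelow`, from Prop. 4.1; or `Door.dmpsDoor_delta_gt` from
Theorem 1.7), the paper's is `𝛅 ≤ 2⁻⁹` (`Door.no_key_asConstructed`), and the unit's two-engine census
puts `E_NN(10) ≥ 0.1608`, `E_NN(11) ≥ 0.1452` rigorously, `≈ 0.25–0.35` at mean-field level.

ABSOLUTE RULE respected: nothing of DMPS is asserted — `Theorem16Conclusion d 1 c C ε δ`,
`PercolationAssumptionI d`, `PercolationAssumptionII d δ` / `NNErrorTermBelow d δ` and `Proposition41Eta d`
enter as hypotheses `(h : X)`; the passage (1.26) ⟹ `x`-space bound ⟹ triangle ⟹ `MeanField d` and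
the lock are kernel-proved (this file, `XSpaceDecayTriangle`, `MeanFieldOfTriangle`, `Door`,
`ErrorTermFloor`).
-/

noncomputable section

open Filter
open _root_.Topology

namespace Literature.Probability.DuminilCopinMarkarPanisSlade2026

open Literature.Probability.LatticeModels (Site zdGraph)
open Literature.Probability.Percolation
open Literature.Probability.FitznerVanDerHofstad2017 (MeanField meanField_of_triangle)

variable {d : ℕ}

/-! ## (1.26) below `β_c` ⟹ the triangle condition -/

/-- **Theorem 1.6-conclusion ⟹ triangle condition.** For `d ≥ 2`, `c, C ≥ 0` and `3ε < d - 6`: the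
conclusion of DMPS Theorem 1.6 at `(c₀ = 1; c, C; ε; δ)`, DMPS §6.3 for nearest-neighbour percolation
and Assumption II at `δ` give `T(p_c) < ∞` on `ℤ^d` — (1.26) for every `β < β_c` is
`τ_p(0,x) ≤ C‖x‖_∞^{-(d-2-ε)}` for all `p < p_c`, `x ≠ 0` (`Door.tau_le_rpow_of_theorem16Conclusion`),
and an `x`-space bound with exponent `a`, `3a > 2d`, uniform below `p_c`, gives the triangle condition
(`triangleCondition_of_tau_le_rpow_subcrit`); here `a = d - 2 - ε`, `3a > 2d ⟺ 3ε < d - 6`.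
[cite: DuminilCopinMarkarPanisSlade2026RandomWalk, Thm. 1.6 p. 9 with (1.26) p. 8; §6.3 pp. 47–49]
[cite: HaraHofstadSlade2003, Prop. 1.7(i), p. 5 (two-point decay |x|^{-(d-2)} ⟹ triangle condition for d > 6)] -/
theorem triangleCondition_of_theorem16Conclusion (hd : 2 ≤ d) {c C ε δ : ℝ} (hc : 0 ≤ c)
    (hC : 0 ≤ C) (hε : 3 * ε < (d : ℝ) - 6) (h16 : Theorem16Conclusion d 1 c C ε δ)
    (hI : PercolationAssumptionI d) (hII : PercolationAssumptionII d δ) : TriangleCondition d :=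
  triangleCondition_of_tau_le_rpow_subcrit (by omega) (a := (d : ℝ) - 2 - ε) (C := C) (by linarith)
    (tau_le_rpow_of_theorem16Conclusion hd hc hC h16 hI hII)

/-- The same with the KEY `E_NN(d) < δ` in place of Assumption II (it implies Assumption II at `δ`,
`Door.percolationAssumptionII_of_nnErrorTermBelow`). [folklore] -/
theorem triangleCondition_of_key (hd : 2 ≤ d) {c C ε δ : ℝ} (hc : 0 ≤ c) (hC : 0 ≤ C)
    (hε : 3 * ε < (d : ℝ) - 6) (h16 : Theorem16Conclusion d 1 c C ε δ) (hI : PercolationAssumptionI d)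
    (hkey : NNErrorTermBelow d δ) : TriangleCondition d :=
  triangleCondition_of_theorem16Conclusion hd hc hC hε h16 hI
    (percolationAssumptionII_of_nnErrorTermBelow hkey)

/-! ## The mean-field door -/

/-- **Theorem 1.6-conclusion ⟹ mean-field exponents.** For `d ≥ 2`, `c, C ≥ 0`, `3ε < d - 6`: the
conclusion of DMPS Theorem 1.6 at `(c₀ = 1; c, C; ε; δ)` ∧ §6.3 ∧ Assumption II at `δ` give
`MeanField d` — `θ(p_c) = 0`, `γ = 1`, `β = 1`, `δ = 2` in the bounded-ratio sense of Fitzner–van der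
Hofstad (1.7)–(1.12) — through the triangle condition (`triangleCondition_of_theorem16Conclusion`) and
Fitzner–van der Hofstad Cor. 1.3 as proved in the tree (`meanField_of_triangle`). No use of
Theorem 1.7. [cite: DuminilCopinMarkarPanisSlade2026RandomWalk, Thm. 1.6 p. 9 with (1.26) p. 8]
[cite: FitznerVanDerHofstad2017, Cor. 1.3] -/
theorem meanField_of_theorem16Conclusion (hd : 2 ≤ d) {c C ε δ : ℝ} (hc : 0 ≤ c) (hC : 0 ≤ C)
    (hε : 3 * ε < (d : ℝ) - 6) (h16 : Theorem16Conclusion d 1 c C ε δ)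
    (hI : PercolationAssumptionI d) (hII : PercolationAssumptionII d δ) : MeanField d :=
  meanField_of_triangle hd (triangleCondition_of_theorem16Conclusion hd hc hC hε h16 hI hII)

/-- **THE MEAN-FIELD DOOR.** For `d ≥ 2`, `c, C ≥ 0`, `3ε < d - 6`: Theorem 1.6-conclusion at
`(c₀ = 1; c, C; ε; δ)` ∧ §6.3 ∧ the key `E_NN(d) < δ` ⟹ `MeanField d`. The room behind the second
door is the triangle condition — the same room the lace expansion opens
(`HaraSlade1990_triangleCondition_of_laceFacts`). [folklore] -/
theorem meanField_of_key (hd : 2 ≤ d) {c C ε δ : ℝ} (hc : 0 ≤ c) (hC : 0 ≤ C)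
    (hε : 3 * ε < (d : ℝ) - 6) (h16 : Theorem16Conclusion d 1 c C ε δ) (hI : PercolationAssumptionI d)
    (hkey : NNErrorTermBelow d δ) : MeanField d :=
  meanField_of_triangle hd (triangleCondition_of_key hd hc hC hε h16 hI hkey)

/-- At the paper's exponent losses `ε ∈ (0,1)` the restriction `3ε < d - 6` is void from `d = 9` on:
for `d ≥ 9`, Theorem 1.6-conclusion at ANY `ε < 1` ∧ §6.3 ∧ the key ⟹ `MeanField d`. [folklore] -/
theorem meanField_of_key_of_lt_one (hd : 9 ≤ d) {c C ε δ : ℝ} (hc : 0 ≤ c) (hC : 0 ≤ C)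
    (hε : ε < 1) (h16 : Theorem16Conclusion d 1 c C ε δ) (hI : PercolationAssumptionI d)
    (hkey : NNErrorTermBelow d δ) : MeanField d := by
  have h9 : (9 : ℝ) ≤ d := by exact_mod_cast hd
  exact meanField_of_key (by omega) hc hC (by linarith) h16 hI hkey

/-- **The mean-field door with its lock.** For `d ≥ 3`, `c, C ≥ 0`, `3ε < d - 6`: Theorem
1.6-conclusion ∧ §6.3 ∧ Proposition 4.1 (junk-free, `Proposition41Eta`) ∧ the key `E_NN(d) < δ` give
`MeanField d` AND force `δ > 1/(2d)` (`Door.inv_two_mul_lt_of_nnErrorTermBelow`: `E(β) ≥ 1 - 1/β` below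
`β_c ≥ 2d/(2d-1)`) — whereas the paper's Theorems 1.5–1.6 come with `𝛅 ≤ 2⁻⁹`
(`Door.no_key_asConstructed`). [folklore] -/
theorem dmpsMeanFieldDoor (hd : 3 ≤ d) {c C ε δ : ℝ} (hc : 0 ≤ c) (hC : 0 ≤ C)
    (hε : 3 * ε < (d : ℝ) - 6) (h16 : Theorem16Conclusion d 1 c C ε δ) (hI : PercolationAssumptionI d)
    (h41 : Proposition41Eta d) (hkey : NNErrorTermBelow d δ) :
    MeanField d ∧ 1 / (2 * d : ℝ) < δ :=
  ⟨meanField_of_key (by omega) hc hC hε h16 hI hkey,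
    inv_two_mul_lt_of_nnErrorTermBelow (by omega) h41 hI hkey⟩

/-- Variant of the lock through Theorem 1.7 instead of Proposition 4.1 (`Door.dmpsDoor_delta_gt`):
Theorem 1.6-conclusion ∧ Theorem 1.7-conclusion ∧ §6.3 ∧ key ⟹ `MeanField d ∧ δ > 1/(2d)` (`d ≥ 2`,
`3ε < d - 6`). [folklore] -/
theorem dmpsMeanFieldDoor' (hd : 2 ≤ d) {c C ε δ : ℝ} (hc : 0 ≤ c) (hC : 0 ≤ C)
    (hε : 3 * ε < (d : ℝ) - 6) (h16 : Theorem16Conclusion d 1 c C ε δ)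
    (h17 : Theorem17Conclusion d 1 δ) (hI : PercolationAssumptionI d) (hkey : NNErrorTermBelow d δ) :
    MeanField d ∧ 1 / (2 * d : ℝ) < δ :=
  ⟨meanField_of_key hd hc hC hε h16 hI hkey, dmpsDoor_delta_gt hd h17 hI hkey⟩

/-! ## Spelled out along the lace ladder, `d = 7, …, 11` -/

/-- `d = 7` (the conjectured bottom of the mean-field regime above `d_c = 6`): Theorem 1.6-conclusion
at an exponent loss `ε < 1/3` ∧ §6.3 ∧ Prop. 4.1 ∧ key ⟹ `MeanField 7`, and the key has `δ > 1/14`.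
[folklore] -/
theorem dmpsMeanFieldDoor_d7 {c C ε δ : ℝ} (hc : 0 ≤ c) (hC : 0 ≤ C) (hε : 3 * ε < 1)
    (h16 : Theorem16Conclusion 7 1 c C ε δ) (hI : PercolationAssumptionI 7)
    (h41 : Proposition41Eta 7) (hkey : NNErrorTermBelow 7 δ) :
    MeanField 7 ∧ (1 : ℝ) / 14 < δ := by
  obtain ⟨h1, h2⟩ := dmpsMeanFieldDoor (d := 7) (by norm_num) hc hC (by norm_num; linarith) h16 hI
    h41 hkey
  norm_num at h2
  exact ⟨h1, h2⟩

/-- `d = 8`: exponent loss `ε < 2/3`; the key has `δ > 1/16`. [folklore] -/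
theorem dmpsMeanFieldDoor_d8 {c C ε δ : ℝ} (hc : 0 ≤ c) (hC : 0 ≤ C) (hε : 3 * ε < 2)
    (h16 : Theorem16Conclusion 8 1 c C ε δ) (hI : PercolationAssumptionI 8)
    (h41 : Proposition41Eta 8) (hkey : NNErrorTermBelow 8 δ) :
    MeanField 8 ∧ (1 : ℝ) / 16 < δ := by
  obtain ⟨h1, h2⟩ := dmpsMeanFieldDoor (d := 8) (by norm_num) hc hC (by norm_num; linarith) h16 hI
    h41 hkey
  norm_num at h2
  exact ⟨h1, h2⟩

/-- `d = 9`: any exponent loss `ε < 1` (the paper's whole range); the key has `δ > 1/18` (census: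
`E_SRW(9) ≈ 0.3855` at mean-field level). [folklore] -/
theorem dmpsMeanFieldDoor_d9 {c C ε δ : ℝ} (hc : 0 ≤ c) (hC : 0 ≤ C) (hε : ε < 1)
    (h16 : Theorem16Conclusion 9 1 c C ε δ) (hI : PercolationAssumptionI 9)
    (h41 : Proposition41Eta 9) (hkey : NNErrorTermBelow 9 δ) :
    MeanField 9 ∧ (1 : ℝ) / 18 < δ := by
  obtain ⟨h1, h2⟩ := dmpsMeanFieldDoor (d := 9) (by norm_num) hc hC (by norm_num; linarith) h16 hI
    h41 hkey
  norm_num at h2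
  exact ⟨h1, h2⟩

/-- `d = 10` (the lace ladder's first OPEN rung): Theorem 1.6-conclusion at any `ε < 4/3` (so at every
`ε` of the paper's range `(0,1)`) ∧ §6.3 ∧ Prop. 4.1 ∧ the key `E_NN(10) < δ` ⟹ `MeanField 10` —
`θ(p_c) = 0`, `γ = 1`, `β = 1`, `δ = 2` on `ℤ^{10}` — and the key has `δ > 1/20 = 0.05` (paper:
`𝛅 ≤ 2⁻⁹ ≈ 0.00195`; census: `E_NN(10) ≥ 0.1608` rigorously, `E_SRW(10) ≈ 0.3026`). [folklore] -/
theorem dmpsMeanFieldDoor_d10 {c C ε δ : ℝ} (hc : 0 ≤ c) (hC : 0 ≤ C) (hε : 3 * ε < 4)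
    (h16 : Theorem16Conclusion 10 1 c C ε δ) (hI : PercolationAssumptionI 10)
    (h41 : Proposition41Eta 10) (hkey : NNErrorTermBelow 10 δ) :
    MeanField 10 ∧ (1 : ℝ) / 20 < δ := by
  obtain ⟨h1, h2⟩ := dmpsMeanFieldDoor (d := 10) (by norm_num) hc hC (by norm_num; linarith) h16 hI
    h41 hkey
  norm_num at h2
  exact ⟨h1, h2⟩

/-- `d = 11` (the lace ladder's floor): any `ε < 5/3`; `MeanField 11` and the key has
`δ > 1/22 ≈ 0.04545` (paper: `𝛅 ≤ 2⁻⁹`; census: `E_NN(11) ≥ 0.1452`, `E_SRW(11) ≈ 0.2503`).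
[folklore] -/
theorem dmpsMeanFieldDoor_d11 {c C ε δ : ℝ} (hc : 0 ≤ c) (hC : 0 ≤ C) (hε : 3 * ε < 5)
    (h16 : Theorem16Conclusion 11 1 c C ε δ) (hI : PercolationAssumptionI 11)
    (h41 : Proposition41Eta 11) (hkey : NNErrorTermBelow 11 δ) :
    MeanField 11 ∧ (1 : ℝ) / 22 < δ := by
  obtain ⟨h1, h2⟩ := dmpsMeanFieldDoor (d := 11) (by norm_num) hc hC (by norm_num; linarith) h16 hI
    h41 hkey
  norm_num at h2
  exact ⟨h1, h2⟩

end Literature.Probability.DuminilCopinMarkarPanisSlade2026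

end
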